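import Summits.AtomisticToContinuum.FouriersLaw.Theses.ContactStieltjesMeasure

/-!
# Sketch (crux-ideate r2 k4) — equilibrium-corrector transfer for the `φ⁴` edge of
`ContactStieltjesMeasure.StieltjesRepresentation` (crux ⇔ `stub_phi4Edge`, p167063).

Statements only (no proofs, no sorry): the first checkable lemma `ExactResponseIdentity`, the
conditional response theorem `ResponseTransfer`, the corrector-as-Lyapunov transfer
`CorrectorLyapunov`, and the residual `EquilibriumPoissonRegularity` (C⁺).
-/

noncomputable section

open MeasureTheory Filter Topology Set
open scoped ContDiff
open Literature.MathematicalPhysics.KineticTheory.HeatConduction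

namespace Summit.AtomisticToContinuum.FouriersLaw.Cruxes.StieltjesRepresentation.IdeasK4

/-- FIRST LEMMA (exact, every `δ`, every `β, lam ≥ 0`, no uniqueness, no mixing): the generator is
affine in the bath temperatures, `L_{T+δ/2,T-δ/2} = L_{T,T} + δ·(γ/2)(∂²_{p_0} - ∂²_{p_{N-1}})`, so for an
equilibrium corrector `F` (`L_{T,T} F = -(p_0² - T)`) with polynomial bounds and ANY weak steady state
`μ` at `(T+δ/2, T-δ/2)` with one polynomial moment,
`∫ (p_0² - T) dμ = δ · (γ/2) ∫ (∂²_{p_0}F - ∂²_{p_{N-1}}F) dμ`. -/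
def ExactResponseIdentity : Prop :=
  ∀ ω₂ lam β γ T δ : ℝ, 0 < ω₂ → 0 ≤ lam → 0 ≤ β → 0 < γ → 0 < T →
    ∀ (N : ℕ) (i₀ i₁ : Fin N), i₀.val = 0 → i₁.val = N - 1 →
    ∀ (F : PhaseSpace N → ℝ) (C : ℝ) (r : ℕ), ContDiff ℝ ∞ F →
      (∀ x, (pinnedChain ω₂ lam β γ).generator N T T F x = -((x.2 i₀) ^ 2 - T)) →
      (∀ x, |F x| ≤ C * (1 + |(pinnedChain ω₂ lam β γ).hamiltonian N x|) ^ r ∧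
        |partialP i₀ F x| ≤ C * (1 + |(pinnedChain ω₂ lam β γ).hamiltonian N x|) ^ r ∧
        |partialP i₁ F x| ≤ C * (1 + |(pinnedChain ω₂ lam β γ).hamiltonian N x|) ^ r ∧
        |partialP i₀ (partialP i₀ F) x| ≤ C * (1 + |(pinnedChain ω₂ lam β γ).hamiltonian N x|) ^ r ∧
        |partialP i₁ (partialP i₁ F) x| ≤ C * (1 + |(pinnedChain ω₂ lam β γ).hamiltonian N x|) ^ r) →
      ∀ μ : Measure (PhaseSpace N),
        (pinnedChain ω₂ lam β γ).IsSteadyState N (T + δ / 2) (T - δ / 2) μ →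
        Integrable (fun x => (1 + |(pinnedChain ω₂ lam β γ).hamiltonian N x|) ^ (r + 1)) μ →
        ∫ x, ((x.2 i₀) ^ 2 - T) ∂μ =
          δ * (γ / 2 * ∫ x, (partialP i₀ (partialP i₀ F) x - partialP i₁ (partialP i₁ F) x) ∂μ)

/-- RESPONSE TRANSFER (fixed `N, γ, T`; all `β, lam ≥ 0`): equilibrium corrector with polynomial
`C²_{p_b}` bounds + ONE uniform polynomial moment of the steady family near `(T,T)` + weak uniqueness
AT `(T,T)` (the crux's own hypothesis, used to identify the weak limit with the Gibbs state) ⇒ the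
crux's linear-response conclusion, with the explicit value
`(N-1)·γ·(1/2 - (γ/2) μ_T(∂²_{p_0}F - ∂²_{p_{N-1}}F))`. -/
def ResponseTransfer : Prop :=
  ∀ ω₂ lam β γ T : ℝ, 0 < ω₂ → 0 ≤ lam → 0 ≤ β → 0 < γ → 0 < T →
    ∀ (N : ℕ) (i₀ i₁ : Fin N), 2 ≤ N → i₀.val = 0 → i₁.val = N - 1 →
    ∀ (F : PhaseSpace N → ℝ) (C : ℝ) (r : ℕ), ContDiff ℝ ∞ F →
      (∀ x, (pinnedChain ω₂ lam β γ).generator N T T F x = -((x.2 i₀) ^ 2 - T)) →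
      (∀ x, |F x| ≤ C * (1 + |(pinnedChain ω₂ lam β γ).hamiltonian N x|) ^ r ∧
        |partialP i₀ F x| ≤ C * (1 + |(pinnedChain ω₂ lam β γ).hamiltonian N x|) ^ r ∧
        |partialP i₁ F x| ≤ C * (1 + |(pinnedChain ω₂ lam β γ).hamiltonian N x|) ^ r ∧
        |partialP i₀ (partialP i₀ F) x| ≤ C * (1 + |(pinnedChain ω₂ lam β γ).hamiltonian N x|) ^ r ∧
        |partialP i₁ (partialP i₁ F) x| ≤ C * (1 + |(pinnedChain ω₂ lam β γ).hamiltonian N x|) ^ r) →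
      (∀ μ ν : Measure (PhaseSpace N), (pinnedChain ω₂ lam β γ).IsSteadyState N T T μ →
        (pinnedChain ω₂ lam β γ).IsSteadyState N T T ν → μ = ν) →
      ∀ μ : (N' : ℕ) → ℝ → ℝ → Measure (PhaseSpace N'),
        (∀ T_L T_R : ℝ, 0 < T_L → 0 < T_R →
          (pinnedChain ω₂ lam β γ).IsSteadyState N T_L T_R (μ N T_L T_R)) →
        (∃ δ₀ M : ℝ, 0 < δ₀ ∧ ∀ δ : ℝ, |δ| < δ₀ →
          Integrable (fun x => (1 + |(pinnedChain ω₂ lam β γ).hamiltonian N x|) ^ (r + 2))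
              (μ N (T + δ / 2) (T - δ / 2)) ∧
            ∫ x, (1 + |(pinnedChain ω₂ lam β γ).hamiltonian N x|) ^ (r + 2)
              ∂(μ N (T + δ / 2) (T - δ / 2)) ≤ M) →
        Tendsto (fun δ : ℝ => (pinnedChain ω₂ lam β γ).totalCurrent (μ N (T + δ / 2) (T - δ / 2)) / δ)
          (𝓝[≠] 0)
          (𝓝 (((N : ℝ) - 1) * γ * (1 / 2 - γ / 2 *
            ∫ x, (partialP i₀ (partialP i₀ F) x - partialP i₁ (partialP i₁ F) x)
              ∂((pinnedChain ω₂ lam β γ).gibbsMeasure N T))))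

/-- CORRECTOR-AS-LYAPUNOV TRANSFER (all `β, lam ≥ 0`): if the EQUILIBRIUM Poisson equation for the
energy weight `w_r = (1+|H|)^r`, `L_{T,T} W = M_w - w_r`, has a smooth, coercive solution bounded below whose
bath-momentum derivatives do not lose (`|∂_{p_b}W|, |∂²_{p_b}W| ≤ C w_r`), then `W` is a Foster–Lyapunov
function for ALL bath temperatures near `(T,T)` and every weak steady state there has `∫ w_r dμ ≤ M`,
uniformly. -/
def CorrectorLyapunov : Prop :=
  ∀ ω₂ lam β γ T : ℝ, 0 < ω₂ → 0 ≤ lam → 0 ≤ β → 0 < γ → 0 < T →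
    ∀ (N r : ℕ) (W : PhaseSpace N → ℝ) (Mw C : ℝ), ContDiff ℝ ∞ W →
      (∀ x, (pinnedChain ω₂ lam β γ).generator N T T W x =
        Mw - (1 + |(pinnedChain ω₂ lam β γ).hamiltonian N x|) ^ r) →
      (∀ x, -C ≤ W x ∧ |(pinnedChain ω₂ lam β γ).hamiltonian N x| ≤ C * (1 + W x)) →
      (∀ (i : Fin N) (x : PhaseSpace N), (i.val = 0 ∨ i.val = N - 1) →
        |partialP i W x| ≤ C * (1 + |(pinnedChain ω₂ lam β γ).hamiltonian N x|) ^ r ∧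
        |partialP i (partialP i W) x| ≤ C * (1 + |(pinnedChain ω₂ lam β γ).hamiltonian N x|) ^ r) →
      ∃ δ₀ M : ℝ, 0 < δ₀ ∧ ∀ T_L T_R : ℝ, |T_L - T| < δ₀ → |T_R - T| < δ₀ →
        ∀ μ : Measure (PhaseSpace N), (pinnedChain ω₂ lam β γ).IsSteadyState N T_L T_R μ →
          Integrable (fun x => (1 + |(pinnedChain ω₂ lam β γ).hamiltonian N x|) ^ r) μ ∧
          ∫ x, (1 + |(pinnedChain ω₂ lam β γ).hamiltonian N x|) ^ r ∂μ ≤ M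

/-- C⁺ — EQUILIBRIUM POISSON REGULARITY for the discrete `φ⁴` chain (`β = 0 < lam`), every length:
at equal bath temperatures `(T,T)` (Gibbs state known and invariant) the Poisson equation
`L_{T,T} W = c - v` has smooth polynomially bounded solutions (i) for every energy weight
`v = (1+|H|)^r`, with NO LOSS in the bath-momentum derivatives, and (ii) for the boundary kinetic
observable `v = p_0² - T`, with polynomial `C²_{p_b}` bounds. This is the single residual of the line:
(i) ⇒ uniform moments (via `CorrectorLyapunov`), (ii) ⇒ the response (via `ResponseTransfer`). -/
def EquilibriumPoissonRegularity : Prop :=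
  ∀ ω₂ lam γ T : ℝ, 0 < ω₂ → 0 < lam → 0 < γ → 0 < T →
    ∀ (N : ℕ) (i₀ i₁ : Fin N), 2 ≤ N → i₀.val = 0 → i₁.val = N - 1 →
      (∀ r : ℕ, ∃ (W : PhaseSpace N → ℝ) (Mw C : ℝ) (r' : ℕ), ContDiff ℝ ∞ W ∧
        (∀ x, (pinnedChain ω₂ lam 0 γ).generator N T T W x =
          Mw - (1 + |(pinnedChain ω₂ lam 0 γ).hamiltonian N x|) ^ r) ∧
        (∀ x, -C ≤ W x ∧ W x ≤ C * (1 + |(pinnedChain ω₂ lam 0 γ).hamiltonian N x|) ^ r' ∧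
          |(pinnedChain ω₂ lam 0 γ).hamiltonian N x| ≤ C * (1 + W x)) ∧
        (∀ (i : Fin N) (x : PhaseSpace N), (i.val = 0 ∨ i.val = N - 1) →
          |partialP i W x| ≤ C * (1 + |(pinnedChain ω₂ lam 0 γ).hamiltonian N x|) ^ r ∧
          |partialP i (partialP i W) x| ≤ C * (1 + |(pinnedChain ω₂ lam 0 γ).hamiltonian N x|) ^ r)) ∧
      (∃ (F : PhaseSpace N → ℝ) (C : ℝ) (r : ℕ), ContDiff ℝ ∞ F ∧
        (∀ x, (pinnedChain ω₂ lam 0 γ).generator N T T F x = -((x.2 i₀) ^ 2 - T)) ∧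
        (∀ x, |F x| ≤ C * (1 + |(pinnedChain ω₂ lam 0 γ).hamiltonian N x|) ^ r ∧
          |partialP i₀ F x| ≤ C * (1 + |(pinnedChain ω₂ lam 0 γ).hamiltonian N x|) ^ r ∧
          |partialP i₁ F x| ≤ C * (1 + |(pinnedChain ω₂ lam 0 γ).hamiltonian N x|) ^ r ∧
          |partialP i₀ (partialP i₀ F) x| ≤ C * (1 + |(pinnedChain ω₂ lam 0 γ).hamiltonian N x|) ^ r ∧
          |partialP i₁ (partialP i₁ F) x| ≤ C * (1 + |(pinnedChain ω₂ lam 0 γ).hamiltonian N x|) ^ r))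

/-- C⁺ (ii, general form used by the pencil core at `β = 0`): EQUILIBRIUM POISSON SOLVERS with
polynomial weights — every smooth, Gibbs-centred, polynomially bounded source `v` has a smooth
polynomially bounded solution of `L_{T,T} w = -v` (the `β = 0` replacement for
`Pencil.exists_poisson_solution`, which rests on the `β > 0` Harris bound). -/
def EquilibriumPoissonSolvers : Prop :=
  ∀ ω₂ lam γ T : ℝ, 0 < ω₂ → 0 < lam → 0 < γ → 0 < T → ∀ (N a : ℕ), 1 ≤ N →
    ∃ (b : ℕ) (K : ℝ), ∀ (v : PhaseSpace N → ℝ) (A : ℝ), ContDiff ℝ ∞ v →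
      (∀ x, |v x| ≤ A * (1 + |(pinnedChain ω₂ lam 0 γ).hamiltonian N x|) ^ a) →
      ∫ x, v x ∂((pinnedChain ω₂ lam 0 γ).gibbsMeasure N T) = 0 →
      ∃ w : PhaseSpace N → ℝ, ContDiff ℝ ∞ w ∧
        (∀ x, (pinnedChain ω₂ lam 0 γ).generator N T T w x = -v x) ∧
        (∀ x, |w x| ≤ K * A * (1 + |(pinnedChain ω₂ lam 0 γ).hamiltonian N x|) ^ b) ∧
        ∫ x, w x ∂((pinnedChain ω₂ lam 0 γ).gibbsMeasure N T) = 0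

/-- Sanity: the crux decl is in scope by name (the line's composition target). -/
example : Prop := Summit.AtomisticToContinuum.FouriersLaw.Theses.ContactStieltjesMeasure.StieltjesRepresentation

end Summit.AtomisticToContinuum.FouriersLaw.Cruxes.StieltjesRepresentation.IdeasK4
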